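/-
Copyright (c) 2026 the pub-hodgecm-mathlib formalisation cell (harness21).  Prover seat hodgecm-mathlib-K2E5-p01 (g4) (free E5 hand, cross-unit), HCML Track B «K2-LIT»,
h413 = `stmt-HodgeConjecture-24833`, line `K2_E3_EllipticInputs`, unit U12, socket #11 road (SC-an), residual road «HC-14-ell» (opened by K2E3-plan (g2) (R-ell)
2026-09-04T03:06Z; (SC-an) line lead K2E3-p14 (g3) MAP v4 «E5 → K2E5-p01 (g4)»), brick E5 «TRANSPORT», FILE B (the head).  2026-09-04.
-/
import Summits.HodgeConjecture.HodgeConjecture.Theorems.K2E3HC14EllCayleyWindows              -- E5 FILE A (this seat): norm-one infinitude, `conj_skew`, the translated windows (`window_data`, `cc_conj`, `continuousOn_cc`, `token_eq_cc_mul`, …)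
import Summits.HodgeConjecture.HodgeConjecture.Theorems.F0P3cStCharTSModelHaarPins              -- ★ (T5) p851908: `locallyCompactSpace_unitaryGroupOfForm`
import Summits.HodgeConjecture.HodgeConjecture.Theorems.K2E3SupercuspBallBoundSplitAssembly   -- ★ (M5e-1) (K2E3-p14): the model frame and the token currency of the two letter cands
import Literature.NumberTheory.Rogawski1990.LocalTransfer                                     -- ★ `IsRegularElt`, `isRegularElt_iff`
import Literature.LinearAlgebra.Matrix.CharpolyDiscTwinBridge                                  -- ★ `discr_eq_zero_iff_not_separable_of_monic`
import HarnessLib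

/-!
# K2 · E3 · (SC-an) residual road «HC-14-ell», brick E5 «TRANSPORT», FILE B: HARISH-CHANDRA'S THEOREM 14 FOR THE COMPACT CARTANS OF `U(σ, Φ₃)(K)` FROM HIS
# THEOREM 13 ON THE LIE ALGEBRA `𝔲(σ, Φ₃)(K)` — `sig_K2E3HC13LieEllRankOne ⟹ sig_K2E3HC14EllRankOne` through the translated Cayley windows

Cell `pub/hodgecm-mathlib`, crux H413 = `stmt-HodgeConjecture-24833` (lane `--supports … --as helper`, count-neutral); (SC-an) line lead K2E3-p14 (g3) (letter cands
`K2/K2E3-p14/g3/sig_K2E3HC14EllRankOne.cand.v1…` 03:09:26Z and `sig_K2E3HC13LieEllRankOne.cand.v1…` 03:12:24Z, conclusions consumed VERBATIM below), dealer K2E3-plan (g2).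
THEOREMS ONLY (no `def` ∕ `instance` ∕ `notation` ∕ named fact ∕ `sorry`); ★-only imports.

THE MATHEMATICS ([HarishChandra1970] Part VI §8, Theorem 14 ⟸ Theorem 13 «by the exponential ∕ Cayley map»; here at rank one, [Rogawski1990 §7.3], [PlatonovRapinchuk1994
§3.3]).  Both letters integrate the SAME Haar variable `x ∈ U = U(σ, Φ₃)(K)`: the Lie letter bounds `|discr χ_X|^{1∕4} · ∫_U Θ(x X x⁻¹) dμ(x)` for elliptic regular `X ∈ 𝔲`,
the group letter `T(γ) · ∫_U Θ(x γ x⁻¹) dμ(x)` for elliptic regular `γ ∈ U`, `T(γ) = (|discr χ_γ| · |det γ|⁻²)^{1∕4}` — so the transport needs NO Jacobian and NO measure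
transport, only: (i) a FINITE COVER of the compact support set `S ⊆ U` by compact pieces `K_j` inside translated Cayley windows `O_{z_j}` at norm-one scalars `z_j` (FILE A §1–§2,
Mathlib `exists_compact_subset` ∕ `IsCompact.elim_nhds_subcover` in the locally compact `U`, ★ (T5)); (ii) on a window, `γ = z · c(X)` with `X = ψ_z(γ)` SKEW, `det(1 ∓ X)`
units (FILE A `window_data`), `X` regular iff `γ` regular (★ E5a `isRegularElt_iff_of_val_eq_smul_cayley` + ★ `discr_eq_zero_iff_not_separable_of_monic`), `Z_U(X) = Z(γ)` (★ E5a
`units_conj_eq_iff_of_val_eq_smul_cayley`), `x γ x⁻¹ = z · c(x X x⁻¹)` (★ `cayley_conj`) and `T(γ) = cc_z(γ) · |discr χ_X|^{1∕4}` (FILE A `token_eq_cc_mul`) with `cc_z`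
conjugation-invariant (FILE A `cc_conj`) hence `≤ D_j := max_{K_j} cc_{z_j}` whenever the orbit of `γ` meets `K_j` (FILE A `continuousOn_cc`, `IsCompact.exists_isMaxOn`);
(iii) the Lie-side weight `Φ_j :=` extension by zero of `(1_{K_j} Θ) ∘ (X ↦ z_j · c(X) ∈ U)` along the Borel set `{X | det(1 ∓ X) units, X skew}` — Borel
(`MeasurableEmbedding.subtype_coe … measurable_extend`, the chart being continuous into `U`), `≤ M`, supported in `ψ_{z_j}(K_j)` (★ `inverseWindow_cayley`), and EQUAL to
`x ↦ (1_{K_j}Θ)(x γ x⁻¹)` along the orbit (★ `cayley_conj`, FILE A `conj_skew`); (iv) `Θ ≤ Σ_j 1_{K_j} Θ`, and the pieces add up: `C_group = (Σ_j D_j) · C_Lie(⋃_j ψ_{z_j}(K_j))`.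
* §3 **`hc14Ell_of_hc13Lie`** — THE HEAD: `(∀ compact S′, ‹sig_K2E3HC13LieEllRankOne conclusion at S′›) → ‹sig_K2E3HC14EllRankOne conclusion›`, bytes verbatim, in the cands' frame
  (`hσv` is not needed and omitted).

HONEST LABEL: HC_CM is proved only modulo the 7 printed citations (2 remaining named inputs: hLiu418 = `stmt-HodgeConjecture-24832`, h413 = `stmt-HodgeConjecture-24833`)
until rung 0 closes; count-neutral helper (E5 of road HC-14-ell; the Lie letter (E1–E4) is NOT proved here; (SC-an) is NOT ★).

## References
* [HarishChandra1970] Harish-Chandra (notes by G. van Dijk), *Harmonic Analysis on Reductive p-adic Groups*, LNM 162 (1970), Part V §3 Theorem 13 p. 44; Part VI §8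
  Theorem 14 p. 60 (the passage Lie algebra → group); Part VII §3 Theorem 19 p. 70.
* [Rogawski1990] J. D. Rogawski, *Automorphic Representations of Unitary Groups in Three Variables* (1990), §7.3 p. 97.
* [PlatonovRapinchuk1994] V. Platonov, A. Rapinchuk, *Algebraic Groups and Number Theory* (1994), §3.3 (Cayley parametrisation of unitary groups).
-/

set_option autoImplicit false
-- the mandated namespace has the single-problem summit's repeated segment (`HodgeConjecture.HodgeConjecture`)
set_option linter.dupNamespace false

noncomputable section

open MeasureTheory Measure Set Filter Topology
open scoped NNReal ENNReal MatrixGroups WithZero Matrix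
open Literature.NumberTheory.Automorphic Literature.NumberTheory.Automorphic.UnitaryGroup Literature.NumberTheory.Rogawski1990
open Literature.NumberTheory.GaloisRepresentations Literature.NumberTheory.GaloisRepresentations.IsNonarchimedeanLocalField
open Literature.NumberTheory.Weil1982.UnitaryFinTopForm Literature.LinearAlgebra.Matrix
open Summit.HodgeConjecture.HodgeConjecture.Cruxes.H413.K2E3CayleyScalingAlgebra
open Summit.HodgeConjecture.HodgeConjecture.Cruxes.H413.K2E3CayleyTokenAlgebra
open Summit.HodgeConjecture.HodgeConjecture.Cruxes.H413.K2E3HC14EllCayleyWindows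

namespace Summit.HodgeConjecture.HodgeConjecture.Cruxes.H413.K2E3HC14EllOfHC13Lie

/-! ## §3 THE TRANSPORT: Harish-Chandra's Theorem 14 for the compact Cartans of `U(σ, Φ₃)(K)` from his Theorem 13 on `𝔲(σ, Φ₃)(K)` -/

section Main

set_option maxHeartbeats 800000 in
-- one long assembly proof (finite cover, chart data, extension by zero); the elaboration of the many coercion-heavy terms needs the extra budget
/-- **E5 «TRANSPORT»: `sig_K2E3HC13LieEllRankOne ⟹ sig_K2E3HC14EllRankOne`.**  In the model frame of the (SC-an) line (`K` a non-archimedean local field of characteristic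
zero, `σ` a continuous involution `≠ id`, `J = Φ₃`, `μ` a Haar measure on `U = ↥(unitaryGroupOfForm σ J)`): IF Harish-Chandra's Theorem 13 holds on the Lie algebra in the
UNIFORM form of the cand `sig_K2E3HC13LieEllRankOne` for EVERY compact `S′ ⊆ M₃(K)` (hypothesis `hLie`, conclusion bytes verbatim), THEN his Theorem 14 holds on the group in
the uniform form of the cand `sig_K2E3HC14EllRankOne` (conclusion bytes verbatim): for every compact `S ⊆ U` one constant `C` with
`T(γ) · ∫⁻ x, Θ (x γ x⁻¹) ∂μ ≤ C · M` for all Borel `Θ` vanishing off `S` and bounded by `M` and all regular `γ` with compact centraliser, `T(γ) = √√(|discr χ_γ| · |det γ|⁻²)`.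
PROOF: finite cover of `S` by compact pieces of translated Cayley windows (§2, ★ `exists_mem_isUnit_det_add_smul_one` over the infinite norm-one set §1), the Lie set
`S′ = ⋃_j ψ_{z_j}(K_j)`, per piece the Borel weight «`1_{K_j}Θ` read through `X ↦ z_j · c(X)`» (extension by zero along the Borel set of skew `X` with `det(1 ∓ X)`
units), ★ E5a for regularity ∕ centraliser ∕ token, the conjugation-invariant chart factor bounded on each piece, and `Θ ≤ Σ_j 1_{K_j} Θ`.
[cite: HarishChandra1970, Part VI §8 Theorem 14 p. 60; Part V §3 Theorem 13 p. 44] [cite: Rogawski1990, §7.3 p. 97] [cite: PlatonovRapinchuk1994, §3.3] -/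
theorem hc14Ell_of_hc13Lie {K : Type*} [Field K] [Valued K ℤᵐ⁰] [ValuativeRel K] [(Valued.v : Valuation K ℤᵐ⁰).Compatible] [IsNonarchimedeanLocalField K]
    [CharZero K] (σ : K →+* K) (hσ : ∀ x, σ (σ x) = x) (hσc : Continuous σ) (hσ1 : ∃ x : K, σ x ≠ x)
    {J : Matrix (Fin 3) (Fin 3) K} (hJ : J = (StdForm.antidiagonal 3).over K)
    [MeasurableSpace ↥(unitaryGroupOfForm σ J)] [BorelSpace ↥(unitaryGroupOfForm σ J)] (μ : Measure ↥(unitaryGroupOfForm σ J)) [μ.IsHaarMeasure]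
    [MeasurableSpace (Matrix (Fin 3) (Fin 3) K)] [BorelSpace (Matrix (Fin 3) (Fin 3) K)]
    (hLie : ∀ ⦃S' : Set (Matrix (Fin 3) (Fin 3) K)⦄, IsCompact S' →
      ∃ C : ℝ≥0, ∀ Θ : Matrix (Fin 3) (Fin 3) K → ℝ≥0∞, Measurable Θ → (∀ X, Θ X ≠ 0 → X ∈ S') → ∀ M : ℝ≥0∞, (∀ X, Θ X ≤ M) →
        ∀ X : Matrix (Fin 3) (Fin 3) K, (X.map σ).transpose * J + J * X = 0 → X.charpoly.discr ≠ 0 →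
          IsCompact {g : ↥(unitaryGroupOfForm σ J) |
            ((g : GL (Fin 3) K) : Matrix (Fin 3) (Fin 3) K) * X * (((g : GL (Fin 3) K)⁻¹ : GL (Fin 3) K) : Matrix (Fin 3) (Fin 3) K) = X} →
            ((normAbs K X.charpoly.discr : ℝ≥0) : ℝ≥0∞) ^ (1 / 4 : ℝ) *
              ∫⁻ g, Θ (((g : GL (Fin 3) K) : Matrix (Fin 3) (Fin 3) K) * X * (((g : GL (Fin 3) K)⁻¹ : GL (Fin 3) K) : Matrix (Fin 3) (Fin 3) K)) ∂μ ≤ C * M)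
    {S : Set ↥(unitaryGroupOfForm σ J)} (hS : IsCompact S) :
    ∃ C : ℝ≥0, ∀ Θ : ↥(unitaryGroupOfForm σ J) → ℝ≥0∞, Measurable Θ → (∀ g, Θ g ≠ 0 → g ∈ S) → ∀ M : ℝ≥0∞, (∀ g, Θ g ≤ M) →
      ∀ γ : ↥(unitaryGroupOfForm σ J), IsRegularElt (γ : GL (Fin 3) K) →
        IsCompact ((Subgroup.centralizer ({γ} : Set ↥(unitaryGroupOfForm σ J))) : Set ↥(unitaryGroupOfForm σ J)) →
          ((NNReal.sqrt (NNReal.sqrt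
              (normAbs K (((γ : GL (Fin 3) K) : Matrix (Fin 3) (Fin 3) K)).charpoly.discr *
                (normAbs K (((γ : GL (Fin 3) K) : Matrix (Fin 3) (Fin 3) K)).det ^ 2)⁻¹)) : ℝ≥0) : ℝ≥0∞) *
            ∫⁻ x, Θ (x * γ * x⁻¹) ∂μ ≤ C * M := by
  classical
  haveI : T2Space K := (IsNonarchimedeanLocalField.isLocalField K).toT2Space
  haveI : LocallyCompactSpace ↥(unitaryGroupOfForm σ J) := F0P3cStCharTSModelHaarPins.locallyCompactSpace_unitaryGroupOfForm σ J hσc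
  have h2 : (2 : K) ≠ 0 := two_ne_zero
  have h2u : IsUnit (2 : K) := isUnit_iff_ne_zero.2 h2
  have hJd : IsUnit J.det := by rw [hJ]; exact Literature.GroupTheory.SpecificGroups.isUnit_det_antidiagonal_three_over
  have hE : {z : K | σ z * z = 1}.Infinite := setOf_mul_self_eq_one_infinite σ hσ hσ1
  -- continuity of conjugation on `U` and of the matrix coercion
  have hconjc : ∀ γ : ↥(unitaryGroupOfForm σ J), Continuous fun x : ↥(unitaryGroupOfForm σ J) => x * γ * x⁻¹ := fun γ => (continuous_id.mul continuous_const).mul continuous_id.inv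
  have hmatc : Continuous fun u : ↥(unitaryGroupOfForm σ J) => ((u : GL (Fin 3) K) : Matrix (Fin 3) (Fin 3) K) := Units.continuous_val.comp continuous_subtype_val
  -- (1) a norm-one window through EVERY point of `U`
  have hzex : ∀ g : ↥(unitaryGroupOfForm σ J), ∃ z : K, σ z * z = 1 ∧ IsUnit (z⁻¹ • ((g : GL (Fin 3) K) : Matrix (Fin 3) (Fin 3) K) + 1).det := by
    intro g
    obtain ⟨z, hz1, hz⟩ := exists_mem_isUnit_det_add_smul_one ((g : GL (Fin 3) K) : Matrix (Fin 3) (Fin 3) K) hE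
    have hz1' : σ z * z = 1 := hz1
    have hz0 : z ≠ 0 := by
      rintro rfl
      rw [mul_zero] at hz1'
      exact zero_ne_one hz1'
    refine ⟨z, hz1', ?_⟩
    have heq : z⁻¹ • ((g : GL (Fin 3) K) : Matrix (Fin 3) (Fin 3) K) + 1 = z⁻¹ • (((g : GL (Fin 3) K) : Matrix (Fin 3) (Fin 3) K) + z • (1 : Matrix (Fin 3) (Fin 3) K)) := by
      rw [smul_add, smul_smul, inv_mul_cancel₀ hz0, one_smul]
    rw [heq, Matrix.det_smul]
    exact ((isUnit_iff_ne_zero.2 (inv_ne_zero hz0)).pow _).mul hz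
  choose z hz1 hzO using hzex
  -- (2) a compact neighbourhood of each point inside its window
  have hKex : ∀ g : ↥(unitaryGroupOfForm σ J), ∃ Kg : Set ↥(unitaryGroupOfForm σ J), IsCompact Kg ∧ g ∈ interior Kg ∧
      Kg ⊆ {u : ↥(unitaryGroupOfForm σ J) | IsUnit ((z g)⁻¹ • ((u : GL (Fin 3) K) : Matrix (Fin 3) (Fin 3) K) + 1).det} :=
    fun g => exists_compact_subset (isOpen_window σ (J := J) (z g)) (hzO g)
  choose Kc hKc hKint hKO using hKex
  have hKm : ∀ g, MeasurableSet (Kc g) := fun g => (hKc g).isClosed.measurableSet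
  -- (3) a finite subcover of `S`
  obtain ⟨t, -, hcover⟩ := hS.elim_nhds_subcover Kc fun g _ => mem_interior_iff_mem_nhds.1 (hKint g)
  -- (4) the chart factor is bounded on each (non-empty, compact) piece
  have hDex : ∀ g : ↥(unitaryGroupOfForm σ J), ∃ D : ℝ≥0, ∀ u ∈ Kc g, NNReal.sqrt (NNReal.sqrt ((normAbs K 2) ^ 6 / (normAbs K ((1 - (((z g)⁻¹ • ((u : GL (Fin 3) K) : Matrix (Fin 3) (Fin 3) K) - 1) * ((z g)⁻¹ • ((u : GL (Fin 3) K) : Matrix (Fin 3) (Fin 3) K) + 1)⁻¹)).det * (1 + (((z g)⁻¹ • ((u : GL (Fin 3) K) : Matrix (Fin 3) (Fin 3) K) - 1) * ((z g)⁻¹ • ((u : GL (Fin 3) K) : Matrix (Fin 3) (Fin 3) K) + 1)⁻¹)).det)) ^ 2)) ≤ D := by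
    intro g
    obtain ⟨u₀, -, hmax⟩ := (hKc g).exists_isMaxOn ⟨g, interior_subset (hKint g)⟩ ((continuousOn_cc σ h2 hJd (hz1 g)).mono (hKO g))
    exact ⟨_, fun u hu => hmax hu⟩
  choose D hD using hDex
  -- (5) the compact Lie-side set
  have hL : IsCompact (⋃ g ∈ t, (fun u : ↥(unitaryGroupOfForm σ J) => (((z g)⁻¹ • ((u : GL (Fin 3) K) : Matrix (Fin 3) (Fin 3) K) - 1) * ((z g)⁻¹ • ((u : GL (Fin 3) K) : Matrix (Fin 3) (Fin 3) K) + 1)⁻¹)) '' Kc g) :=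
    t.isCompact_biUnion fun g _ => (hKc g).image_of_continuousOn ((continuousOn_psi σ (J := J) (z g)).mono (hKO g))
  obtain ⟨C, hC⟩ := hLie hL
  refine ⟨(∑ g ∈ t, D g) * C, ?_⟩
  intro Θ hΘm hΘS M hΘM γ hreg hcpt
  -- (6) `Θ ≤ Σ_j 1_{K_j} Θ`
  have hle : ∀ u : ↥(unitaryGroupOfForm σ J), Θ u ≤ ∑ g ∈ t, (Kc g).indicator Θ u := by
    intro u
    by_cases hu : Θ u = 0
    · rw [hu]; exact bot_le
    · obtain ⟨g, hgt, hug⟩ := Set.mem_iUnion₂.1 (hcover (hΘS u hu))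
      calc Θ u = (Kc g).indicator Θ u := (Set.indicator_of_mem hug Θ).symm
        _ ≤ ∑ g' ∈ t, (Kc g').indicator Θ u := Finset.single_le_sum (f := fun g' => (Kc g').indicator Θ u) (fun _ _ => bot_le) hgt
  -- (7) the bound on one piece
  have hpiece : ∀ g ∈ t,
      ((NNReal.sqrt (NNReal.sqrt (normAbs K ((γ : GL (Fin 3) K) : Matrix (Fin 3) (Fin 3) K).charpoly.discr * (normAbs K ((γ : GL (Fin 3) K) : Matrix (Fin 3) (Fin 3) K).det ^ 2)⁻¹)) : ℝ≥0) : ℝ≥0∞) *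
        ∫⁻ x, (Kc g).indicator Θ (x * γ * x⁻¹) ∂μ ≤ (D g : ℝ≥0∞) * (C * M) := by
    intro g hg
    by_cases hhit : ∃ x₀ : ↥(unitaryGroupOfForm σ J), x₀ * γ * x₀⁻¹ ∈ Kc g
    swap
    · -- the orbit of `γ` misses the piece: the integrand vanishes identically
      push Not at hhit
      have h0 : (fun x : ↥(unitaryGroupOfForm σ J) => (Kc g).indicator Θ (x * γ * x⁻¹)) = fun _ => 0 :=
        funext fun x => Set.indicator_of_notMem (hhit x) Θ
      rw [h0, lintegral_zero, mul_zero]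
      exact bot_le
    obtain ⟨x₀, hx₀⟩ := hhit
    -- the window at `z g` contains the orbit point `x₀ γ x₀⁻¹`, hence `γ` itself
    have hγO : IsUnit ((z g)⁻¹ • ((γ : GL (Fin 3) K) : Matrix (Fin 3) (Fin 3) K) + 1).det := by
      have h₀ := hKO g hx₀
      simp only [Set.mem_setOf_eq] at h₀
      have hconj : (z g)⁻¹ • ((((x₀ * γ * x₀⁻¹ : ↥(unitaryGroupOfForm σ J)) : GL (Fin 3) K) : Matrix (Fin 3) (Fin 3) K)) + 1 =
          (((x₀ : GL (Fin 3) K) : Matrix (Fin 3) (Fin 3) K)) * ((z g)⁻¹ • ((γ : GL (Fin 3) K) : Matrix (Fin 3) (Fin 3) K) + 1) * ((((x₀ : GL (Fin 3) K)⁻¹ : GL (Fin 3) K) : Matrix (Fin 3) (Fin 3) K)) := by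
        rw [Subgroup.coe_mul, Subgroup.coe_mul, Subgroup.coe_inv, Units.val_mul, Units.val_mul, ← Matrix.smul_mul, ← Matrix.mul_smul,
          (conj_add_one (x₀ : GL (Fin 3) K) _).1]
      rw [hconj, Matrix.det_units_conj] at h₀
      exact h₀
    obtain ⟨hskew, hm, hp, hγeq⟩ := window_data σ h2 hJd (hz1 g) γ hγO
    have hz0 : z g ≠ 0 := by
      intro h0
      have := hz1 g
      rw [h0, mul_zero] at this
      exact zero_ne_one this
    have hzu : IsUnit (z g) := isUnit_iff_ne_zero.2 hz0
    -- the Lie element `X = ψ_{z g}(γ)`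
    set X : Matrix (Fin 3) (Fin 3) K := (((z g)⁻¹ • ((γ : GL (Fin 3) K) : Matrix (Fin 3) (Fin 3) K) - 1) * ((z g)⁻¹ • ((γ : GL (Fin 3) K) : Matrix (Fin 3) (Fin 3) K) + 1)⁻¹) with hXdef
    -- `X` is regular semisimple and has the compact centraliser `Z(γ)`
    have hXreg : X.charpoly.discr ≠ 0 := by
      have hsep : X.charpoly.Separable := (isRegularElt_iff_of_val_eq_smul_cayley h2u hm hzu hγeq).1 hreg
      exact fun h0 => (discr_eq_zero_iff_not_separable_of_monic (Matrix.charpoly_monic X)).1 h0 hsep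
    have hZ : IsCompact {x : ↥(unitaryGroupOfForm σ J) | (((x : GL (Fin 3) K) : Matrix (Fin 3) (Fin 3) K)) * X * ((((x : GL (Fin 3) K)⁻¹ : GL (Fin 3) K) : Matrix (Fin 3) (Fin 3) K)) = X} := by
      have hset : {x : ↥(unitaryGroupOfForm σ J) | (((x : GL (Fin 3) K) : Matrix (Fin 3) (Fin 3) K)) * X * ((((x : GL (Fin 3) K)⁻¹ : GL (Fin 3) K) : Matrix (Fin 3) (Fin 3) K)) = X} = ((Subgroup.centralizer ({γ} : Set ↥(unitaryGroupOfForm σ J))) : Set ↥(unitaryGroupOfForm σ J)) := by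
        ext x
        rw [Set.mem_setOf_eq, SetLike.mem_coe, Subgroup.mem_centralizer_iff, ← units_conj_eq_iff_of_val_eq_smul_cayley h2u hm hzu hγeq (x : GL (Fin 3) K)]
        simp only [Set.mem_singleton_iff, forall_eq]
        rw [← Subgroup.coe_mul, ← Subgroup.coe_inv, ← Subgroup.coe_mul, Subtype.coe_inj, mul_inv_eq_iff_eq_mul, eq_comm]
      rw [hset]; exact hcpt
    -- the Borel set of chart parameters and the chart into `U`
    let Oset : Set (Matrix (Fin 3) (Fin 3) K) := {Y | IsUnit (1 - Y).det ∧ IsUnit (1 + Y).det ∧ (Y.map σ)ᵀ * J + J * Y = 0}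
    have hOm : MeasurableSet Oset := by
      have h1 : IsOpen {Y : Matrix (Fin 3) (Fin 3) K | IsUnit (1 - Y).det} := by
        have : {Y : Matrix (Fin 3) (Fin 3) K | IsUnit (1 - Y).det} = (fun Y : Matrix (Fin 3) (Fin 3) K => (1 - Y).det) ⁻¹' {0}ᶜ := by
          ext Y; simp only [Set.mem_setOf_eq, Set.mem_preimage, Set.mem_compl_iff, Set.mem_singleton_iff, isUnit_iff_ne_zero]
        rw [this]; exact isOpen_compl_singleton.preimage (continuous_const.sub continuous_id).matrix_det
      have h2' : IsOpen {Y : Matrix (Fin 3) (Fin 3) K | IsUnit (1 + Y).det} := by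
        have : {Y : Matrix (Fin 3) (Fin 3) K | IsUnit (1 + Y).det} = (fun Y : Matrix (Fin 3) (Fin 3) K => (1 + Y).det) ⁻¹' {0}ᶜ := by
          ext Y; simp only [Set.mem_setOf_eq, Set.mem_preimage, Set.mem_compl_iff, Set.mem_singleton_iff, isUnit_iff_ne_zero]
        rw [this]; exact isOpen_compl_singleton.preimage (continuous_const.add continuous_id).matrix_det
      have h3 : IsClosed {Y : Matrix (Fin 3) (Fin 3) K | (Y.map σ)ᵀ * J + J * Y = 0} :=
        isClosed_eq (((continuous_id.matrix_map hσc).matrix_transpose.mul continuous_const).add (continuous_const.mul continuous_id)) continuous_const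
      have hO : Oset = {Y : Matrix (Fin 3) (Fin 3) K | IsUnit (1 - Y).det} ∩ ({Y | IsUnit (1 + Y).det} ∩ {Y | (Y.map σ)ᵀ * J + J * Y = 0}) := by
        ext Y; simp only [Oset, Set.mem_setOf_eq, Set.mem_inter_iff]
      rw [hO]
      exact h1.measurableSet.inter (h2'.measurableSet.inter h3.measurableSet)
    -- every chart parameter gives a unitary `z g · c(Y)`
    have hunit : ∀ Y : ↥Oset, (((z g) • cayley (Y : Matrix (Fin 3) (Fin 3) K)).map σ)ᵀ * J * ((z g) • cayley (Y : Matrix (Fin 3) (Fin 3) K)) = J :=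
      fun Y => transpose_map_smul_mul_smul_of_unitary σ (transpose_map_cayley_mul_mul_cayley σ Y.2.1 Y.2.2.2) (hz1 g)
    have hdet : ∀ Y : ↥Oset, ((z g) • cayley (Y : Matrix (Fin 3) (Fin 3) K)).det ≠ 0 :=
      fun Y => (isUnit_det_of_unitary σ (hunit Y) hJd).ne_zero
    let chart : ↥Oset → ↥(unitaryGroupOfForm σ J) := fun Y =>
      ⟨Matrix.GeneralLinearGroup.mkOfDetNeZero _ (hdet Y), mem_unitaryGroupOfForm_iff.2 (hunit Y)⟩
    have hchart_val : ∀ Y : ↥Oset, (((chart Y : ↥(unitaryGroupOfForm σ J)) : GL (Fin 3) K) : Matrix (Fin 3) (Fin 3) K) = (z g) • cayley (Y : Matrix (Fin 3) (Fin 3) K) :=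
      fun Y => rfl
    have hchart_cont : Continuous chart := by
      refine Continuous.subtype_mk ?_ _
      rw [Units.continuous_iff]
      have hc : Continuous fun Y : ↥Oset => (z g) • cayley (Y : Matrix (Fin 3) (Fin 3) K) :=
        ((continuousOn_cayley_window (n := Fin 3) (K := K)).comp_continuous continuous_subtype_val fun Y => Y.2.1).const_smul (z g)
      refine ⟨hc, ?_⟩
      -- the inverse: matrix inversion is continuous at the invertible matrices `z g · c(Y)`
      have hci : ∀ Y : ↥Oset, ContinuousAt (fun B : Matrix (Fin 3) (Fin 3) K => B⁻¹) ((z g) • cayley (Y : Matrix (Fin 3) (Fin 3) K)) := by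
        intro Y
        refine continuousAt_matrix_inv _ ?_
        rw [Ring.inverse_eq_inv']
        exact continuousAt_inv₀ (hdet Y)
      have hinv : Continuous fun Y : ↥Oset => ((z g) • cayley (Y : Matrix (Fin 3) (Fin 3) K))⁻¹ :=
        continuous_iff_continuousAt.2 fun Y =>
          ContinuousAt.comp (f := fun Y : ↥Oset => (z g) • cayley (Y : Matrix (Fin 3) (Fin 3) K))
            (g := fun B : Matrix (Fin 3) (Fin 3) K => B⁻¹) (hci Y) hc.continuousAt
      convert hinv using 1
      funext Y
      rw [Matrix.coe_units_inv, hchart_val]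
    -- the Lie-side weight: extension by zero of `(1_{K_g} Θ) ∘ chart`
    let Φ : Matrix (Fin 3) (Fin 3) K → ℝ≥0∞ :=
      Function.extend (Subtype.val : ↥Oset → Matrix (Fin 3) (Fin 3) K) (fun Y => (Kc g).indicator Θ (chart Y)) (fun _ => (0 : ℝ≥0∞))
    have hΦm : Measurable Φ :=
      (MeasurableEmbedding.subtype_coe hOm).measurable_extend ((hΘm.indicator (hKm g)).comp hchart_cont.measurable) measurable_const
    have hΦ_on : ∀ (Y : Matrix (Fin 3) (Fin 3) K) (hY : Y ∈ Oset), Φ Y = (Kc g).indicator Θ (chart ⟨Y, hY⟩) :=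
      fun Y hY => Subtype.val_injective.extend_apply _ _ ⟨Y, hY⟩
    have hΦ_off : ∀ Y : Matrix (Fin 3) (Fin 3) K, Y ∉ Oset → Φ Y = 0 := by
      intro Y hY
      show Function.extend Subtype.val _ (fun _ => (0 : ℝ≥0∞)) Y = 0
      rw [Function.extend_apply' _ _ _ fun ⟨a, ha⟩ => hY (ha ▸ a.2)]
    have hΦM : ∀ Y, Φ Y ≤ M := by
      intro Y
      by_cases hY : Y ∈ Oset
      · rw [hΦ_on Y hY]
        exact (Set.indicator_le_self _ _ _).trans (hΘM _)
      · rw [hΦ_off Y hY]; exact bot_le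
    have hΦsupp : ∀ Y, Φ Y ≠ 0 → Y ∈ ⋃ g ∈ t, (fun u : ↥(unitaryGroupOfForm σ J) => (((z g)⁻¹ • ((u : GL (Fin 3) K) : Matrix (Fin 3) (Fin 3) K) - 1) * ((z g)⁻¹ • ((u : GL (Fin 3) K) : Matrix (Fin 3) (Fin 3) K) + 1)⁻¹)) '' Kc g := by
      intro Y hY
      by_cases hYO : Y ∈ Oset
      swap
      · exact absurd (hΦ_off Y hYO) hY
      rw [hΦ_on Y hYO] at hY
      have hmemK : chart ⟨Y, hYO⟩ ∈ Kc g := Set.mem_of_indicator_ne_zero hY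
      refine Set.mem_iUnion₂.2 ⟨g, hg, chart ⟨Y, hYO⟩, hmemK, ?_⟩
      -- `ψ(z·c(Y)) = Y`
      show ((z g)⁻¹ • (((chart ⟨Y, hYO⟩ : ↥(unitaryGroupOfForm σ J)) : GL (Fin 3) K) : Matrix (Fin 3) (Fin 3) K) - 1) *
          ((z g)⁻¹ • (((chart ⟨Y, hYO⟩ : ↥(unitaryGroupOfForm σ J)) : GL (Fin 3) K) : Matrix (Fin 3) (Fin 3) K) + 1)⁻¹ = Y
      rw [hchart_val, smul_smul, inv_mul_cancel₀ hz0, one_smul]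
      exact inverseWindow_cayley h2u hYO.1
    -- along the orbit the Lie weight IS the group weight
    have hΦorbit : ∀ x : ↥(unitaryGroupOfForm σ J), Φ ((((x : GL (Fin 3) K) : Matrix (Fin 3) (Fin 3) K)) * X * ((((x : GL (Fin 3) K)⁻¹ : GL (Fin 3) K) : Matrix (Fin 3) (Fin 3) K))) = (Kc g).indicator Θ (x * γ * x⁻¹) := by
      intro x
      obtain ⟨-, -, hadd, hsub⟩ := conj_add_one (x : GL (Fin 3) K) X
      have hYO : (((x : GL (Fin 3) K) : Matrix (Fin 3) (Fin 3) K)) * X * ((((x : GL (Fin 3) K)⁻¹ : GL (Fin 3) K) : Matrix (Fin 3) (Fin 3) K)) ∈ Oset := by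
        refine ⟨?_, ?_, conj_skew σ J x hskew⟩
        · rw [← hsub, Matrix.det_units_conj]; exact hm
        · rw [← hadd, Matrix.det_units_conj]; exact hp
      rw [hΦ_on _ hYO]
      congr 1
      apply Subtype.ext
      apply Units.ext
      rw [hchart_val, Subgroup.coe_mul, Subgroup.coe_mul, Subgroup.coe_inv, Units.val_mul, Units.val_mul, hγeq,
        cayley_conj (x : GL (Fin 3) K) hm, Matrix.mul_smul, Matrix.smul_mul]
    -- Theorem 13 on the piece
    have hLie := hC Φ hΦm hΦsupp M hΦM X hskew hXreg hZ
    have hint : ∫⁻ x, (Kc g).indicator Θ (x * γ * x⁻¹) ∂μ = ∫⁻ x, Φ ((((x : GL (Fin 3) K) : Matrix (Fin 3) (Fin 3) K)) * X * ((((x : GL (Fin 3) K)⁻¹ : GL (Fin 3) K) : Matrix (Fin 3) (Fin 3) K))) ∂μ :=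
      lintegral_congr fun x => (hΦorbit x).symm
    -- the chart factor at `γ` is bounded by `D g` (conjugation invariance + the orbit point in the piece)
    have hcc : NNReal.sqrt (NNReal.sqrt ((normAbs K 2) ^ 6 / (normAbs K ((1 - (((z g)⁻¹ • ((γ : GL (Fin 3) K) : Matrix (Fin 3) (Fin 3) K) - 1) * ((z g)⁻¹ • ((γ : GL (Fin 3) K) : Matrix (Fin 3) (Fin 3) K) + 1)⁻¹)).det * (1 + (((z g)⁻¹ • ((γ : GL (Fin 3) K) : Matrix (Fin 3) (Fin 3) K) - 1) * ((z g)⁻¹ • ((γ : GL (Fin 3) K) : Matrix (Fin 3) (Fin 3) K) + 1)⁻¹)).det)) ^ 2)) ≤ D g := by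
      rw [← cc_conj σ (J := J) x₀ γ hγO]
      exact hD g _ hx₀
    rw [hint, token_eq_cc_mul σ h2 hJd (hz1 g) γ hγO, mul_assoc]
    exact mul_le_mul' (ENNReal.coe_le_coe.2 hcc) hLie
  -- (8) assemble
  have hmeas : ∀ g ∈ t, Measurable fun x : ↥(unitaryGroupOfForm σ J) => (Kc g).indicator Θ (x * γ * x⁻¹) :=
    fun g _ => (hΘm.indicator (hKm g)).comp (hconjc γ).measurable
  calc ((NNReal.sqrt (NNReal.sqrt (normAbs K ((γ : GL (Fin 3) K) : Matrix (Fin 3) (Fin 3) K).charpoly.discr * (normAbs K ((γ : GL (Fin 3) K) : Matrix (Fin 3) (Fin 3) K).det ^ 2)⁻¹)) : ℝ≥0) : ℝ≥0∞) *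
        ∫⁻ x, Θ (x * γ * x⁻¹) ∂μ
      ≤ ((NNReal.sqrt (NNReal.sqrt (normAbs K ((γ : GL (Fin 3) K) : Matrix (Fin 3) (Fin 3) K).charpoly.discr * (normAbs K ((γ : GL (Fin 3) K) : Matrix (Fin 3) (Fin 3) K).det ^ 2)⁻¹)) : ℝ≥0) : ℝ≥0∞) *
        ∫⁻ x, ∑ g ∈ t, (Kc g).indicator Θ (x * γ * x⁻¹) ∂μ := mul_le_mul' le_rfl (lintegral_mono fun x => hle _)
    _ = ∑ g ∈ t, ((NNReal.sqrt (NNReal.sqrt (normAbs K ((γ : GL (Fin 3) K) : Matrix (Fin 3) (Fin 3) K).charpoly.discr * (normAbs K ((γ : GL (Fin 3) K) : Matrix (Fin 3) (Fin 3) K).det ^ 2)⁻¹)) : ℝ≥0) : ℝ≥0∞) *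
        ∫⁻ x, (Kc g).indicator Θ (x * γ * x⁻¹) ∂μ := by rw [lintegral_finsetSum _ hmeas, Finset.mul_sum]
    _ ≤ ∑ g ∈ t, (D g : ℝ≥0∞) * (C * M) := Finset.sum_le_sum hpiece
    _ = ((((∑ g ∈ t, D g) * C : ℝ≥0)) : ℝ≥0∞) * M := by
      rw [← Finset.sum_mul, ENNReal.coe_mul, mul_assoc]
      push_cast
      rfl

end Main

end Summit.HodgeConjecture.HodgeConjecture.Cruxes.H413.K2E3HC14EllOfHC13Lie

end
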